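import Summits.BirchSwinnertonDyer.BirchSwinnertonDyer.Theorems.KimAtThreeKolyvaginUnitLevelOneRungs
import HarnessLib

/-!
# Route `KimAtThreeKolyvagin` (rung W2): the `∂`-functional ⟺ CERTIFICATE dictionary for the deep cruxes

The three cruxes of the route are typed in the `∂`-vocabulary of
`KuriharaNumberInvariants` / `KuriharaNumberDeepInvariants` (`∂⁽⁰⁾(δ̃) = kuriharaPartial _ _ _ 0`,
`∂^{(∞)}_{deep}(δ̃) = kuriharaPartialDeepInfty` = `⨅_i ⨆_k ⨅_{n ∈ 𝒩_k cyclic, ν(n) = i} min(k, ord δ̃_n)`),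
whereas every per-pair consumer of the cell, the cell's Cor C-t NAME `N11.KimAtThreeDeepCertPUB`
(p399215) and the (a′) END theorems of cell n1011 (`GaloisImage/KuriharaLowerBoundThree*`) speak of
CERTIFICATES: one Kurihara number `δ̃_n ≢ 0 (mod 3^j)` at one cyclic level `n ∈ 𝒩_k(E,3)`. This file is
the kernel dictionary between the two languages (pure `ℕ∞` bookkeeping on the tree's definitions —
NO Galois-cohomological input, nothing asserted, general `p` where the statement is general):

* `kuriharaDivIndex_le_coe_iff` / `coe_le_kuriharaDivIndex_iff`: `ord δ̃_n ≤ m ⟺ δ̃_n ∉ p^{m+1}ℤ_p/I_n`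
  (a certificate of depth `m + 1` at `n`), `m ≤ ord δ̃_n ⟺ δ̃_n ∈ p^m ℤ_p/I_n`;
* `kuriharaPartialDeepAt_le_coe_iff`, `kuriharaPartialDeep_le_coe_iff_frequently`,
  `kuriharaPartialDeepInfty_le_coe_iff`, `coe_le_kuriharaPartialDeepAt_iff`,
  `coe_le_kuriharaPartialDeep_iff`: the deep functionals versus certificates at deep levels;
* **`deepUpper_conclusion_iff_certificateSupply`**: for a row with `∂⁽⁰⁾(δ̃) = a` and any `s : ℕ`
  (read `s = ord_p #Ш(p)`), the conclusion of crux `DeepUpperAtThree` (item 19076) —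
  `∃ d, ∂^{(∞)}_{deep} = d ∧ s + d ≤ ∂⁽⁰⁾` — is EQUIVALENT to `s ≤ a` together with a SUPPLY of
  certificates of depth `a − s + 1` at arbitrarily deep cyclic levels with a bounded number of prime
  factors (Kato's side: non-vanishing of the derived classes at core vertices);
* **`deepLower_conclusion_iff_eventuallyDivisible`**: the conclusion of crux `DeepLowerAtThree`
  (item 19075) — `∃ d, ∂^{(∞)}_{deep} = d ∧ ∂⁽⁰⁾ ≤ s + d` — is EQUIVALENT to finiteness of the deep
  limit together with: for every `i` and every `j` with `s + j < a`, beyond some depth NO cyclic level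
  with `ν(n) = i` carries a certificate of depth `j + 1` (Mazur–Rubin rigidity: deep classes are
  divisible by `p^{∂^{(∞)}}`);
* `shallowEqDeep_conclusion_iff_noShallowCertificate`: the conclusion of crux
  `ShallowEqDeepAtTorsionFree` (item 19077) ⟺ no cyclic level (however shallow) carries a certificate
  of depth `≤ ∂^{(∞)}_{deep}`.
The sequel `KimAtThreeKolyvaginDeepLowerOfCertificate` derives `DeepLowerAtThree` from the UNIFORM
certificate statement (Cor C-t shape) and, on parametrised rows, from the cell's landed Cor C-t name
`N11.KimAtThreeDeepCertPUB`. Nothing here proves a crux; every statement is an equivalence or an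
implication between typed shapes.
[cite: MazurRubin2004, Def. 4.5.7, Def. 5.2.11, Thm. 5.2.12 (i)] [cite: Kim2022StructureSelmer, §1.5.1 (PDF p. 7), Def. 2.13 (PDF p. 14), Thm. 1.9 (6)]
[cite: Kim2025RefinedTNC, Thm 1.1, Thm 1.2]
-/

set_option autoImplicit false
-- the Theorems namespace of a single-conjunct summit repeats the summit name by design (D-0017)
set_option linter.dupNamespace false

noncomputable section

open scoped MatrixGroups ModularForm Classical

open CongruenceSubgroup WeierstrassCurve Literature.NumberTheory.EllipticCurves
  Literature.NumberTheory.EllipticCurves.ModularForms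

namespace Summit.BirchSwinnertonDyer.BirchSwinnertonDyer.Theorems.KimAtThreeKolyvaginCertificateDictionary

open Summit.BirchSwinnertonDyer.Rank1Residual.Additive
open Summit.BirchSwinnertonDyer.BirchSwinnertonDyer.Theses.KimAtThreeKolyvagin
open Summit.BirchSwinnertonDyer.BirchSwinnertonDyer.Theorems.KimAtThreeKolyvaginDeepUpperRung
open Summit.BirchSwinnertonDyer.BirchSwinnertonDyer.Theorems.KimAtThreeKolyvaginUnitLevelOneRungs

/-! ### Certificates versus the divisibility index of one Kurihara number (general `p`) -/

section Index

variable (W : WeierstrassCurve ℚ) [W.IsGloballyMinimal] (p : ℕ) {N : ℕ} (f : CuspForm (Gamma0 N) 2)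

/-- **`ord δ̃_n ≤ m ⟺ δ̃_n ∉ p^{m+1} ℤ_p/I_n`**: the divisibility index is at most `m` exactly when the
level `n` carries a CERTIFICATE of depth `m + 1` (`¬ KuriharaDivisibleAt _ _ _ n (m + 1)`: for some
`k ≤ m + 1` with `n ∈ 𝒩_k` and some surjective discrete logarithms, `δ̃_n ≢ 0 (mod p^k)`).
[cite: Kim2022StructureSelmer, §1.5.1 (PDF p. 7), Def. 2.13 (PDF p. 14)] -/
theorem kuriharaDivIndex_le_coe_iff (n m : ℕ) :
    kuriharaDivIndex W p f n ≤ (m : ℕ∞) ↔ ¬ KuriharaDivisibleAt W p f n (m + 1) := by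
  constructor
  · intro h hdiv
    have h' := (le_kuriharaDivIndex_of_divisibleAt W p f hdiv).trans h
    have h'' : m + 1 ≤ m := by exact_mod_cast h'
    omega
  · intro h
    rw [kuriharaDivIndex_def]
    refine iSup₂_le fun j hj => ?_
    by_contra hlt
    have hmj : m + 1 ≤ j := by
      have : ¬ j ≤ m := fun hle => hlt (by exact_mod_cast hle)
      omega
    exact h (hj.anti hmj)

/-- **`m ≤ ord δ̃_n ⟺ δ̃_n ∈ p^m ℤ_p/I_n`** (`KuriharaDivisibleAt _ _ _ n m`).
[cite: Kim2022StructureSelmer, §1.5.1 (PDF p. 7), Def. 2.13 (PDF p. 14)] -/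
theorem coe_le_kuriharaDivIndex_iff (n m : ℕ) :
    (m : ℕ∞) ≤ kuriharaDivIndex W p f n ↔ KuriharaDivisibleAt W p f n m := by
  refine ⟨fun h => ?_, le_kuriharaDivIndex_of_divisibleAt W p f⟩
  rcases m with _ | m
  · exact kuriharaDivisibleAt_zero W p f n
  · by_contra hnot
    have h' := h.trans ((kuriharaDivIndex_le_coe_iff W p f n m).mpr hnot)
    have h'' : m + 1 ≤ m := by exact_mod_cast h'
    omega

/-- **An explicit non-zero Kurihara number is a certificate**: `n ∈ 𝒩_k`, `k ≤ j`, surjective `ψ` and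
`kuriharaNumber f (p^k) n ψ ≠ 0` give `δ̃_n ∉ p^j ℤ_p/I_n`. [cite: Kim2022StructureSelmer, §1.5.1 (PDF p. 7)] -/
theorem not_kuriharaDivisibleAt_of_kuriharaNumber_ne_zero {n k j : ℕ} [NeZero n] (hkj : k ≤ j)
    (hk : Kato.IsKolyvaginProduct W p k n)
    (ψ : (ℓ : ℕ) → (ZMod ℓ)ˣ →* Multiplicative (ZMod (p ^ k)))
    (hψ : ∀ ℓ ∈ n.primeFactors, Function.Surjective (ψ ℓ))
    (hne : kuriharaNumber f (p ^ k) n ψ ≠ 0) : ¬ KuriharaDivisibleAt W p f n j :=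
  fun h => hne (h k hkj hk ψ hψ)

/-- **A certificate yields an explicit non-zero Kurihara number**: `δ̃_n ∉ p^j ℤ_p/I_n` gives a depth
`1 ≤ k ≤ j` with `n ∈ 𝒩_k` and surjective discrete logarithms `ψ` with `kuriharaNumber f (p^k) n ψ ≠ 0`
(`k = 0` is excluded since `ℤ/p^0 = 0`). [cite: Kim2022StructureSelmer, §1.4.3 and §1.5.1 (PDF p. 7)] -/
theorem exists_kuriharaNumber_ne_zero_of_not_kuriharaDivisibleAt {n j : ℕ}
    (h : ¬ KuriharaDivisibleAt W p f n j) :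
    ∃ k, 1 ≤ k ∧ k ≤ j ∧ ∃ hk : Kato.IsKolyvaginProduct W p k n,
      ∃ ψ : (ℓ : ℕ) → (ZMod ℓ)ˣ →* Multiplicative (ZMod (p ^ k)),
        (∀ ℓ ∈ n.primeFactors, Function.Surjective (ψ ℓ)) ∧
          (haveI : NeZero n := ⟨hk.ne_zero⟩; kuriharaNumber f (p ^ k) n ψ ≠ 0) := by
  unfold KuriharaDivisibleAt at h
  push Not at h
  obtain ⟨k, hkj, hk, ψ, hψ, hne⟩ := h
  refine ⟨k, ?_, hkj, hk, ψ, hψ, hne⟩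
  rcases Nat.eq_zero_or_pos k with rfl | hpos
  · exfalso
    haveI : Subsingleton (ZMod (p ^ 0)) := ZMod.subsingleton_iff.mpr (pow_zero p)
    exact hne (Subsingleton.elim _ _)
  · exact hpos

end Index

/-! ### Certificates versus the deep functionals (general `p`) -/

section Deep

variable (W : WeierstrassCurve ℚ) [W.IsGloballyMinimal] (p : ℕ) {N : ℕ} (f : CuspForm (Gamma0 N) 2)

/-- **`∂^{(i)}(δ̃^{(k)}) ≤ m` (for `k > m`) ⟺ some cyclic `n ∈ 𝒩_k` with `ν(n) = i` carries a
certificate of depth `m + 1`.** (If every such level had `δ̃_n ∈ p^{m+1}ℤ_p/I_n`, each term of the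
infimum would be `≥ min(k, m+1) = m + 1`.) [cite: MazurRubin2004, Def. 4.5.7] [cite: Kim2022StructureSelmer, Def. 2.13 (PDF p. 14)] -/
theorem kuriharaPartialDeepAt_le_coe_iff {k m : ℕ} (hmk : m < k) (i : ℕ) :
    kuriharaPartialDeepAt W p f k i ≤ (m : ℕ∞) ↔
      ∃ n, IsCyclicKolyvaginLevel W p n ∧ Kato.IsKolyvaginProduct W p k n ∧
        n.primeFactors.card = i ∧ ¬ KuriharaDivisibleAt W p f n (m + 1) := by
  constructor
  · intro h
    by_contra hne
    push Not at hne
    have hle : ((m + 1 : ℕ) : ℕ∞) ≤ kuriharaPartialDeepAt W p f k i := by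
      rw [kuriharaPartialDeepAt_def]
      refine le_iInf fun n => le_iInf fun hn => le_iInf fun hk => le_iInf fun hi => ?_
      refine le_min (by exact_mod_cast hmk) ?_
      exact (coe_le_kuriharaDivIndex_iff W p f n (m + 1)).mpr (hne n hn hk hi)
    have h' : m + 1 ≤ m := by exact_mod_cast hle.trans h
    omega
  · rintro ⟨n, hn, hk, hi, hcert⟩
    exact (kuriharaPartialDeepAt_le W p f hn hk hi).trans
      ((min_le_right _ _).trans ((kuriharaDivIndex_le_coe_iff W p f n m).mpr hcert))

/-- **`m ≤ ∂^{(i)}(δ̃^{(k)})` ⟺ every cyclic `n ∈ 𝒩_k` with `ν(n) = i` has `m ≤ k` and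
`δ̃_n ∈ p^m ℤ_p/I_n`** (no certificate of depth `≤ m` at depth `k`; vacuous if there is no such level).
[cite: MazurRubin2004, Def. 4.5.7] -/
theorem coe_le_kuriharaPartialDeepAt_iff (k i m : ℕ) :
    (m : ℕ∞) ≤ kuriharaPartialDeepAt W p f k i ↔
      ∀ n, IsCyclicKolyvaginLevel W p n → Kato.IsKolyvaginProduct W p k n →
        n.primeFactors.card = i → m ≤ k ∧ KuriharaDivisibleAt W p f n m := by
  rw [kuriharaPartialDeepAt_def]
  simp only [le_iInf_iff, le_min_iff, Nat.cast_le, coe_le_kuriharaDivIndex_iff]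

/-- `∂^{(i)}_{deep}(δ̃) ≤ m ⟺ ∂^{(i)}(δ̃^{(k)}) ≤ m` at every depth `k` (the deep invariant is the
supremum of the non-decreasing sequence). [cite: MazurRubin2004, Thm. 5.2.12 (i)] -/
theorem kuriharaPartialDeep_le_coe_iff (i m : ℕ) :
    kuriharaPartialDeep W p f i ≤ (m : ℕ∞) ↔ ∀ k, kuriharaPartialDeepAt W p f k i ≤ m :=
  iSup_le_iff

/-- **`∂^{(i)}_{deep}(δ̃) ≤ m` ⟺ certificates of depth `m + 1` at cyclic levels with `ν(n) = i` exist
at EVERY depth `k > m`** (by monotonicity the depths `k ≤ m` impose nothing).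
[cite: MazurRubin2004, Def. 4.5.7, Thm. 5.2.12 (i)] [cite: Kim2022StructureSelmer, Def. 2.13 (PDF p. 14)] -/
theorem kuriharaPartialDeep_le_coe_iff_frequently (i m : ℕ) :
    kuriharaPartialDeep W p f i ≤ (m : ℕ∞) ↔
      ∀ k, m < k → ∃ n, IsCyclicKolyvaginLevel W p n ∧ Kato.IsKolyvaginProduct W p k n ∧
        n.primeFactors.card = i ∧ ¬ KuriharaDivisibleAt W p f n (m + 1) := by
  rw [kuriharaPartialDeep_le_coe_iff]
  constructor
  · intro h k hk
    exact (kuriharaPartialDeepAt_le_coe_iff W p f hk i).mp (h k)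
  · intro h k
    rcases Nat.lt_or_ge m k with hk | hk
    · exact (kuriharaPartialDeepAt_le_coe_iff W p f hk i).mpr (h k hk)
    · exact (kuriharaPartialDeepAt_mono W p f (show k ≤ m + 1 by omega) i).trans
        ((kuriharaPartialDeepAt_le_coe_iff W p f (Nat.lt_succ_self m) i).mpr
          (h (m + 1) (Nat.lt_succ_self m)))

/-- **`m ≤ ∂^{(i)}_{deep}(δ̃)` ⟺ `m ≤ ∂^{(i)}(δ̃^{(k)})` at SOME depth `k`** (`ℕ∞` is discrete below a
finite `m`: if every term of the supremum is `≤ m − 1`, so is the supremum).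
[cite: MazurRubin2004, Thm. 5.2.12 (i)] -/
theorem coe_le_kuriharaPartialDeep_iff (i m : ℕ) :
    (m : ℕ∞) ≤ kuriharaPartialDeep W p f i ↔ ∃ k, (m : ℕ∞) ≤ kuriharaPartialDeepAt W p f k i := by
  refine ⟨fun h => ?_, fun ⟨k, hk⟩ => hk.trans (kuriharaPartialDeepAt_le_kuriharaPartialDeep W p f k i)⟩
  by_contra hne
  push Not at hne
  rcases m with _ | m
  · exact absurd (hne 0) (not_lt.mpr (by simp))
  · have hle : kuriharaPartialDeep W p f i ≤ (m : ℕ∞) := by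
      refine iSup_le fun k => ?_
      exact (ENat.lt_add_one_iff (ENat.coe_ne_top m)).mp (by exact_mod_cast hne k)
    have h' : m + 1 ≤ m := by exact_mod_cast h.trans hle
    omega

/-- **`∂^{(∞)}_{deep}(δ̃) ≤ m` ⟺ `∂^{(i)}_{deep}(δ̃) ≤ m` for SOME `i`.**
[cite: MazurRubin2004, Def. 5.2.11] -/
theorem kuriharaPartialDeepInfty_le_coe_iff (m : ℕ) :
    kuriharaPartialDeepInfty W p f ≤ (m : ℕ∞) ↔ ∃ i, kuriharaPartialDeep W p f i ≤ m := by
  refine ⟨fun h => ?_, fun ⟨i, hi⟩ => (kuriharaPartialDeepInfty_le W p f i).trans hi⟩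
  by_contra hne
  push Not at hne
  have hle : ((m + 1 : ℕ) : ℕ∞) ≤ kuriharaPartialDeepInfty W p f := by
    refine le_iInf fun i => ?_
    have := (ENat.add_one_le_iff (ENat.coe_ne_top m)).mpr (hne i)
    exact_mod_cast this
  have h' : m + 1 ≤ m := by exact_mod_cast hle.trans h
  omega

/-- `∂^{(∞)}_{deep}(δ̃)` is ATTAINED: `= ∂^{(i)}_{deep}(δ̃)` for some `i` (an infimum over `ℕ` in the
well-order `ℕ∞`). [cite: MazurRubin2004, Def. 5.2.11] -/
theorem exists_kuriharaPartialDeep_eq_kuriharaPartialDeepInfty :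
    ∃ i, kuriharaPartialDeep W p f i = kuriharaPartialDeepInfty W p f :=
  ENat.exists_eq_iInf _

/-- `∂⁽⁰⁾_{deep}(δ̃) ≤ ord δ̃_1`: the level `n = 1` is cyclic and lies in every `𝒩_k`.
[cite: MazurRubin2004, Def. 4.5.7] [cite: Kim2022StructureSelmer, §1.4.2 and §1.5.1 (PDF p. 7)] -/
theorem kuriharaPartialDeep_zero_le_kuriharaDivIndex_one :
    kuriharaPartialDeep W p f 0 ≤ kuriharaDivIndex W p f 1 := by
  refine iSup_le fun k => ?_
  exact (kuriharaPartialDeepAt_le W p f (isCyclicKolyvaginLevel_one W p) Kato.IsKolyvaginProduct.one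
    (by rw [Nat.primeFactors_one, Finset.card_empty])).trans (min_le_right _ _)

/-- **`∂^{(∞)}_{deep}(δ̃) ≤ ∂⁽⁰⁾(δ̃)`**; in particular the deep limit is FINITE as soon as `δ̃_1 ≠ 0`
(analytic rank `0`). [cite: MazurRubin2004, Def. 5.2.11] [cite: Kim2022StructureSelmer, §1.5.1 (PDF p. 7)] -/
theorem kuriharaPartialDeepInfty_le_kuriharaPartial_zero :
    kuriharaPartialDeepInfty W p f ≤ kuriharaPartial W p f 0 := by
  rw [kuriharaPartial_zero]
  exact (kuriharaPartialDeepInfty_le W p f 0).trans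
    (kuriharaPartialDeep_zero_le_kuriharaDivIndex_one W p f)

/-- In analytic rank `0` (`ord(δ̃) = 0`) the deep limit is a natural number.
[cite: Kim2022StructureSelmer, §1.4.4 and §1.5.1 (PDF p. 7)] -/
theorem exists_kuriharaPartialDeepInfty_eq_natCast_of_kuriharaVanishingOrder_eq_zero
    (hord : kuriharaVanishingOrder W p f = 0) :
    ∃ d : ℕ, kuriharaPartialDeepInfty W p f = d := by
  refine ENat.ne_top_iff_exists.mp ?_ |>.imp fun d hd => hd.symm
  refine (lt_of_le_of_lt ?_ (kuriharaDivIndex_one_lt_top_of_kuriharaVanishingOrder_eq_zero W p f hord)).ne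
  rw [← kuriharaPartial_zero]
  exact kuriharaPartialDeepInfty_le_kuriharaPartial_zero W p f

end Deep

/-! ### The two deep cruxes in certificate language (general `p`; `s` stands for `ord_p #Ш(p)`) -/

section Cruxes

variable (W : WeierstrassCurve ℚ) [W.IsGloballyMinimal] (p : ℕ) {N : ℕ} (f : CuspForm (Gamma0 N) 2)

/-- **Crux `DeepUpperAtThree` ⟺ CERTIFICATE SUPPLY.** On a row with `∂⁽⁰⁾(δ̃) = a` (finite) and for any
`s : ℕ`: `(∃ d, ∂^{(∞)}_{deep}(δ̃) = d ∧ s + d ≤ ∂⁽⁰⁾(δ̃))` holds iff `s ≤ a` and, for some `i`, every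
depth `k > a − s` has a cyclic level `n ∈ 𝒩_k` with `ν(n) = i` and `δ̃_n ∉ p^{a−s+1}ℤ_p/I_n`
(i.e. `ord_p(δ̃_n mod p^k) ≤ a − s`). With `s = ord₃ #Ш(3)` this is item 19076's conclusion: the
Kato side must SUPPLY deep certificates of depth `∂⁽⁰⁾ − ord₃ #Ш(3) + 1`.
[cite: MazurRubin2004, Def. 4.5.7, Def. 5.2.11, Thm. 5.2.12 (i)] [cite: Kim2025RefinedTNC, Thm 1.1] -/
theorem deepUpper_conclusion_iff_certificateSupply {a : ℕ} (ha : kuriharaPartial W p f 0 = a) (s : ℕ) :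
    (∃ d : ℕ, kuriharaPartialDeepInfty W p f = d ∧
        ((s + d : ℕ) : ℕ∞) ≤ kuriharaPartial W p f 0) ↔
      s ≤ a ∧ ∃ i, ∀ k, a - s < k → ∃ n, IsCyclicKolyvaginLevel W p n ∧
        Kato.IsKolyvaginProduct W p k n ∧ n.primeFactors.card = i ∧
          ¬ KuriharaDivisibleAt W p f n (a - s + 1) := by
  rw [ha]
  constructor
  · rintro ⟨d, hd, hle⟩
    have hsd : s + d ≤ a := by exact_mod_cast hle
    refine ⟨by omega, ?_⟩
    have hdle : kuriharaPartialDeepInfty W p f ≤ ((a - s : ℕ) : ℕ∞) := by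
      rw [hd]; exact_mod_cast (show d ≤ a - s by omega)
    obtain ⟨i, hi⟩ := (kuriharaPartialDeepInfty_le_coe_iff W p f (a - s)).mp hdle
    exact ⟨i, (kuriharaPartialDeep_le_coe_iff_frequently W p f i (a - s)).mp hi⟩
  · rintro ⟨hsa, i, hi⟩
    have hdle : kuriharaPartialDeepInfty W p f ≤ ((a - s : ℕ) : ℕ∞) :=
      (kuriharaPartialDeepInfty_le_coe_iff W p f (a - s)).mpr
        ⟨i, (kuriharaPartialDeep_le_coe_iff_frequently W p f i (a - s)).mpr hi⟩
    obtain ⟨d, hd⟩ : ∃ d : ℕ, kuriharaPartialDeepInfty W p f = d :=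
      (ENat.ne_top_iff_exists.mp (lt_of_le_of_lt hdle (ENat.coe_lt_top _)).ne).imp
        fun d hd => hd.symm
    refine ⟨d, hd, ?_⟩
    rw [hd] at hdle
    have : d ≤ a - s := by exact_mod_cast hdle
    exact_mod_cast (show s + d ≤ a by omega)

/-- **Crux `DeepLowerAtThree` ⟺ EVENTUAL DIVISIBILITY (rigidity in certificate language).** On a row
with `∂⁽⁰⁾(δ̃) = a` and for any `s : ℕ`: `(∃ d, ∂^{(∞)}_{deep}(δ̃) = d ∧ ∂⁽⁰⁾(δ̃) ≤ s + d)` holds iff the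
deep limit is finite and, for every `i` and every `j` with `s + j < a`, BEYOND SOME DEPTH `k` every
cyclic `n ∈ 𝒩_k` with `ν(n) = i` has `δ̃_n ∈ p^{j+1}ℤ_p/I_n` — no certificate of depth
`≤ ∂⁽⁰⁾ − s` survives at deep levels. With `s = ord₃ #Ш(3)` this is item 19075's conclusion.
[cite: MazurRubin2004, Thm. 5.2.12, Cor. 5.2.13] [cite: Kim2025RefinedTNC, Thm 1.1] -/
theorem deepLower_conclusion_iff_eventuallyDivisible {a : ℕ} (ha : kuriharaPartial W p f 0 = a) (s : ℕ) :
    (∃ d : ℕ, kuriharaPartialDeepInfty W p f = d ∧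
        kuriharaPartial W p f 0 ≤ ((s + d : ℕ) : ℕ∞)) ↔
      kuriharaPartialDeepInfty W p f < ⊤ ∧
      ∀ i j : ℕ, s + j < a → ∃ k, ∀ n, IsCyclicKolyvaginLevel W p n →
        Kato.IsKolyvaginProduct W p k n → n.primeFactors.card = i →
          KuriharaDivisibleAt W p f n (j + 1) := by
  rw [ha]
  constructor
  · rintro ⟨d, hd, hle⟩
    have had : a ≤ s + d := by exact_mod_cast hle
    refine ⟨by rw [hd]; exact ENat.coe_lt_top d, fun i j hj => ?_⟩
    -- `j + 1 ≤ d ≤ ∂^{(i)}_{deep}`, attained at some depth `k`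
    have hji : ((j + 1 : ℕ) : ℕ∞) ≤ kuriharaPartialDeep W p f i := by
      refine le_trans ?_ (hd ▸ kuriharaPartialDeepInfty_le W p f i)
      exact_mod_cast (show j + 1 ≤ d by omega)
    obtain ⟨k, hk⟩ := (coe_le_kuriharaPartialDeep_iff W p f i (j + 1)).mp hji
    exact ⟨k, fun n hn hkn hi => ((coe_le_kuriharaPartialDeepAt_iff W p f k i (j + 1)).mp hk
      n hn hkn hi).2⟩
  · rintro ⟨hfin, hdiv⟩
    obtain ⟨d, hd⟩ : ∃ d : ℕ, kuriharaPartialDeepInfty W p f = d :=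
      (ENat.ne_top_iff_exists.mp hfin.ne).imp fun d hd => hd.symm
    refine ⟨d, hd, ?_⟩
    by_contra hlt
    have hsd : s + d < a := by
      by_contra hge
      exact hlt (by exact_mod_cast (not_lt.mp hge))
    -- the infimum over `i` is attained
    obtain ⟨i, hi⟩ := exists_kuriharaPartialDeep_eq_kuriharaPartialDeepInfty W p f
    obtain ⟨k, hk⟩ := hdiv i d hsd
    -- at depth `k' = max k (d + 1)` every level is `p^{d+1}`-divisible, so `∂^{(i)}(δ̃^{(k')}) ≥ d + 1`
    have hle : ((d + 1 : ℕ) : ℕ∞) ≤ kuriharaPartialDeepAt W p f (max k (d + 1)) i := by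
      refine (coe_le_kuriharaPartialDeepAt_iff W p f _ i (d + 1)).mpr fun n hn hkn hin => ?_
      exact ⟨le_max_right _ _, hk n hn (hkn.mono (le_max_left _ _)) hin⟩
    have h' := (hle.trans (kuriharaPartialDeepAt_le_kuriharaPartialDeep W p f _ i))
    rw [hi, hd] at h'
    have h'' : d + 1 ≤ d := by exact_mod_cast h'
    omega

/-- **Crux `ShallowEqDeepAtTorsionFree` ⟺ NO SHALLOW CERTIFICATE below the deep limit**:
`∂^{(∞)}_{deep}(δ̃) ≤ ∂^{(∞)}(δ̃)` iff every certificate of depth `j + 1` at ANY cyclic level `n`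
(however shallow) has `∂^{(∞)}_{deep}(δ̃) ≤ j`. (Item 19077's conclusion; its failure is exactly a
shallow unit-type certificate strictly below the deep limit — the route's cheapest falsifier.)
[cite: Kim2022StructureSelmer, §1.5.1 (PDF p. 7)] [cite: Kim2025RefinedTNC, Thm 1.1] -/
theorem shallowEqDeep_conclusion_iff_noShallowCertificate :
    kuriharaPartialDeepInfty W p f ≤ kuriharaPartialInfty W p f ↔
      ∀ n j : ℕ, IsCyclicKolyvaginLevel W p n → ¬ KuriharaDivisibleAt W p f n (j + 1) →
        kuriharaPartialDeepInfty W p f ≤ j := by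
  constructor
  · intro h n j hn hcert
    refine h.trans ((kuriharaPartialInfty_le W p f _).trans ((kuriharaPartial_le W p f hn rfl).trans ?_))
    exact (kuriharaDivIndex_le_coe_iff W p f n j).mpr hcert
  · intro h
    refine le_iInf fun i => ?_
    rw [kuriharaPartial_def]
    refine le_iInf fun n => le_iInf fun hn => le_iInf fun _ => ?_
    induction hx : kuriharaDivIndex W p f n using ENat.recTopCoe with
    | top => exact le_top
    | coe j =>
      rcases j with _ | j
      · -- index `0`: a certificate of depth `1` at `n`
        have hcert : ¬ KuriharaDivisibleAt W p f n (0 + 1) :=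
          (kuriharaDivIndex_le_coe_iff W p f n 0).mp hx.le
        exact_mod_cast h n 0 hn hcert
      · have hcert : ¬ KuriharaDivisibleAt W p f n (j + 1 + 1) :=
          (kuriharaDivIndex_le_coe_iff W p f n (j + 1)).mp hx.le
        exact h n (j + 1) hn hcert

end Cruxes

end Summit.BirchSwinnertonDyer.BirchSwinnertonDyer.Theorems.KimAtThreeKolyvaginCertificateDictionary

end
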